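import Summits.BirchSwinnertonDyer.BirchSwinnertonDyer.Theorems.KolyvaginRoadThreeSchneiderTamAtThreeHeightLogNumeratorSplitChecker
import HarnessLib

/-!
# The split `p`-adic height — THE FIRST DIGIT IN CLOSED FORM (the «finite case table by Kodaira type» on the split
# locus): `ĥ_p^{split}(Q) ≡ −(a^{p−1} − 1) − z(Q)²·(c₆/c₄)/N_L  (mod p·max)`, and the DIGIT CRITERION for the rows on
# which the valuation criterion of `…SplitChecker` is silent (`α + v_L = v_p(den x)`)

HONEST FRAMING (cell `bsd-stepL`, seat `bsd-stepL-tam3-p2` g4; `--supports stmt-BirchSwinnertonDyer-19154 --as helper`):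
THEOREMS ONLY, route-free; 0 definitions, 0 named facts, 0 sorry; ONE curve per application of the checker; nothing
class-wide about Schneider's conjecture; BSD asserted nowhere. Continuation of `…Split` / `…SplitChecker`.

THE LAW. `W/ℚ` minimal, multiplicative at the odd prime `p` (Kodaira `I_ν`), `q` THE Tate parameter, `Q = (x, y)` rational
with `‖x‖_p > 1`, `a = num x`, `z = −x/y` (`z² = a²·den x/b²`), `A = a^{p−1} − 1`, `N_L = U^{p−1} − c₄^{6(p−1)}`
(`U = Δ'c₄³ + 744p^νΔ'²`, `Δ = p^νΔ'`), `T₀ = z²·(c₆/c₄)/N_L` (a RATIONAL number). Then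
**`‖ĥ_p^{split}(Q) + A + T₀‖ ≤ max(p⁻¹‖A‖, p⁻¹‖T₀‖, ‖x‖⁻¹)`** — both leading terms of the split height are explicit
rationals of the integer model and the point, and each is known to one more digit:
* `‖log_p a + A‖ ≤ p⁻¹‖A‖` (`log_p a = (p−1)⁻¹L(a^{p−1})`, `(p−1)⁻¹ ≡ −1`);
* `‖log_p q_E + N_L‖ ≤ p⁻¹‖N_L‖` (unit part to second order from `j`, `c₄^{6(p−1)} ≡ 1`);
* `‖log_E(z)² − z²‖ ≤ p⁻¹‖z‖²` (formal logarithm), `‖C⁻² + c₆/c₄‖ ≤ ‖q‖` (`C⁻² = −(c₆/c₄)·E₄(q)/E₆(q)`).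
(the two-term law itself and the checkers are in the continuation files `…SplitTwoTerm` / `…SplitDigitChecker`; THIS file
proves the four one-more-digit lemmas). DIGIT CRITERION (`certSplit_of_digitRow_padic`, `p ≥ 5`; `p = 3` twin alike): with `e = p^k e'`,
`α := 2k − v_L`, `p^α·m = a^{p−1} − 1` (so `v_p(a^{p−1} − 1) ≥ α` — the rows where `…SplitChecker` is silent or where the
𝓛-term leads), `N_L = p^{v_L}·n_L`, `p ∤ n_L`: **`p ∤ m·b²c₄n_L + a²e'²c₆ ⟹ ĥ_p^{split}(Q) ≠ 0`**, `‖ĥ^{split}‖ = p^{−α}`.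

EVIDENCE (numerics/check_split_law.py on lane A's REG3CERT/v2 table, kit j249895): the predicted first digit
`−m − a²e'²c₆/(b²c₄n_L) (mod p)` agrees with the tabulated 48-digit split height on EVERY one of the 2 338 rows with
`α = τ` (465 fire, 1 873 have digit `0` and tabulated valuation `> α` — 1 743 of those are points `Q = p·Q'`), and the
valuation cases on the other 1 011 rows; 0 violations.

References: [SteinWuthrich2013] §4.2 (p. 16); [SilvermanATAEC1994] Ch. V §1 (1.1), Thm. V.3.1(b), Lemma V.5.1;
[SilvermanAEC2009] IV.6.3–6.4, VII.2.2; [Iwasawa1972PadicL] §4.4; [MazurSteinTate2006] §1.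
-/

noncomputable section

open scoped Classical
open Filter Topology IsUltrametricDist
open WeierstrassCurve Literature.NumberTheory.EllipticCurves
open Literature.NumberTheory.EllipticCurves.SteinWuthrich2013
open Literature.NumberTheory.EllipticCurves.TateCurve
open Literature.NumberTheory.EllipticCurves.Rank1Residual
open Summit.BirchSwinnertonDyer.Uniform.UI.O2
open Summit.BirchSwinnertonDyer.Rank1Residual Summit.BirchSwinnertonDyer.Rank1Residual.X11b

namespace Summit.BirchSwinnertonDyer.Rank1Residual.X11b.RegMult.HeightLogNumerator

variable {p : ℕ} [Fact p.Prime]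

/-! ### §7 One more digit of each factor -/

section Digits

/-- **Relative-error bookkeeping (ultrametric)**: if `‖X − X₀‖ ≤ r‖X₀‖`, `‖Y − Y₀‖ ≤ r‖Y₀‖`, `‖V − V₀‖ ≤ r‖V₀‖` with
`r < 1` and `V₀ ≠ 0`, then `‖XY/V − X₀Y₀/V₀‖ ≤ r·‖X₀Y₀/V₀‖`. [folklore] -/
theorem norm_mul_div_sub_le_of_rel {X X₀ Y Y₀ V V₀ : ℚ_[p]} {r : ℝ} (hr0 : 0 ≤ r) (hr : r < 1) (hV₀ : V₀ ≠ 0)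
    (hX : ‖X - X₀‖ ≤ r * ‖X₀‖) (hY : ‖Y - Y₀‖ ≤ r * ‖Y₀‖) (hV : ‖V - V₀‖ ≤ r * ‖V₀‖) :
    ‖X * Y / V - X₀ * Y₀ / V₀‖ ≤ r * ‖X₀ * Y₀ / V₀‖ := by
  -- `V ≠ 0` and `‖V‖ = ‖V₀‖`
  have hVlt : ‖V - V₀‖ < ‖V₀‖ := by
    refine hV.trans_lt ?_
    calc r * ‖V₀‖ < 1 * ‖V₀‖ := mul_lt_mul_of_pos_right hr (norm_pos_iff.mpr hV₀)
      _ = ‖V₀‖ := one_mul _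
  have hVn : ‖V‖ = ‖V₀‖ := by
    have h := norm_add_eq_max_of_norm_ne_norm hVlt.ne'
    rw [add_sub_cancel, max_eq_left hVlt.le] at h
    exact h
  have hV0 : V ≠ 0 := norm_pos_iff.mp (by rw [hVn]; exact norm_pos_iff.mpr hV₀)
  -- numerator: `XY − X₀Y₀ = (X − X₀)Y + X₀(Y − Y₀)`
  have hYn : ‖Y‖ ≤ ‖Y₀‖ := by
    have hr1 : r * ‖Y₀‖ ≤ ‖Y₀‖ := by
      calc r * ‖Y₀‖ ≤ 1 * ‖Y₀‖ := mul_le_mul_of_nonneg_right hr.le (norm_nonneg _)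
        _ = ‖Y₀‖ := one_mul _
    calc ‖Y‖ = ‖Y₀ + (Y - Y₀)‖ := by rw [add_sub_cancel]
      _ ≤ max ‖Y₀‖ ‖Y - Y₀‖ := IsUltrametricDist.norm_add_le_max Y₀ (Y - Y₀)
      _ ≤ ‖Y₀‖ := max_le le_rfl (hY.trans hr1)
  have hnum : ‖X * Y - X₀ * Y₀‖ ≤ r * (‖X₀‖ * ‖Y₀‖) := by
    have e : X * Y - X₀ * Y₀ = (X - X₀) * Y + X₀ * (Y - Y₀) := by ring
    rw [e]
    refine (norm_add_le_max _ _).trans (max_le ?_ ?_)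
    · rw [norm_mul]
      calc ‖X - X₀‖ * ‖Y‖ ≤ (r * ‖X₀‖) * ‖Y₀‖ := mul_le_mul hX hYn (norm_nonneg _) (by positivity)
        _ = r * (‖X₀‖ * ‖Y₀‖) := by ring
    · rw [norm_mul]
      calc ‖X₀‖ * ‖Y - Y₀‖ ≤ ‖X₀‖ * (r * ‖Y₀‖) := mul_le_mul_of_nonneg_left hY (norm_nonneg _)
        _ = r * (‖X₀‖ * ‖Y₀‖) := by ring
  -- `XY/V − X₀Y₀/V₀ = (XY − X₀Y₀)/V + X₀Y₀(V₀ − V)/(V V₀)`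
  have e : X * Y / V - X₀ * Y₀ / V₀ = (X * Y - X₀ * Y₀) / V + X₀ * Y₀ * (V₀ - V) / (V * V₀) := by
    field_simp
    ring
  rw [e]
  refine (norm_add_le_max _ _).trans (max_le ?_ ?_)
  · rw [norm_div, hVn, norm_div, norm_mul, ← mul_div_assoc]
    exact div_le_div_of_nonneg_right hnum (norm_nonneg V₀)
  · rw [norm_div, norm_mul, norm_mul, norm_mul, hVn, norm_sub_rev, norm_div, norm_mul]
    have hV₀pos : 0 < ‖V₀‖ := norm_pos_iff.mpr hV₀
    calc ‖X₀‖ * ‖Y₀‖ * ‖V - V₀‖ / (‖V₀‖ * ‖V₀‖) ≤ ‖X₀‖ * ‖Y₀‖ * (r * ‖V₀‖) / (‖V₀‖ * ‖V₀‖) := by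
          gcongr
      _ = r * (‖X₀‖ * ‖Y₀‖ / ‖V₀‖) := by field_simp

/-- **The logarithm of an integer unit to its second digit**: `p` odd, `p ∤ a`, `A = a^{p−1} − 1`:
`‖log_p a + A‖ ≤ p⁻¹·‖A‖` (`log_p a = (p−1)⁻¹·L(a^{p−1})`, `‖L(y) + (1 − y)‖ ≤ ‖1 − y‖²`, `(p−1)⁻¹ + 1 = p(p−1)⁻¹`, and
`‖A‖ ≤ p⁻¹`). [cite: Iwasawa1972PadicL, §4.4] -/
theorem norm_padicLog_intCast_add_le (hp2 : p ≠ 2) {a : ℤ} (ha : ¬ (p : ℤ) ∣ a) :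
    ‖padicLog p (a : ℚ_[p]) + (((a : ℚ_[p])) ^ (p - 1) - 1)‖ ≤ (p : ℝ)⁻¹ * ‖((a : ℚ_[p])) ^ (p - 1) - 1‖ := by
  have hpP : p.Prime := Fact.out
  have hp1 : (1 : ℝ) < p := by exact_mod_cast hpP.one_lt
  have ha1 : ‖(a : ℚ_[p])‖ = 1 := BinaryQuartic.norm_intCast_eq_one ha
  have ha0 : (a : ℚ_[p]) ≠ 0 := norm_pos_iff.mp (by rw [ha1]; exact one_pos)
  have hval : (a : ℚ_[p]).valuation = 0 := by
    have h := Padic.norm_eq_zpow_neg_valuation ha0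
    rw [ha1] at h
    have h' : (p : ℝ) ^ (0 : ℤ) = (p : ℝ) ^ (-(a : ℚ_[p]).valuation) := by rw [zpow_zero]; exact h
    have := zpow_right_injective₀ (by positivity) hp1.ne' h'
    omega
  set y : ℚ_[p] := ((a : ℚ_[p])) ^ (p - 1) with hy
  set A : ℚ_[p] := y - 1 with hA
  -- `‖A‖ ≤ p⁻¹` (an integer of norm `< 1`)
  have hAlt : ‖1 - y‖ < 1 := by
    rw [norm_sub_rev]; exact norm_pow_sub_one_lt_one_of_norm_eq_one ha1
  have hAle : ‖A‖ ≤ (p : ℝ)⁻¹ := by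
    have hAint : A = (((a ^ (p - 1) - 1 : ℤ)) : ℚ_[p]) := by rw [hA, hy]; push_cast; ring
    have hlt : ‖(((a ^ (p - 1) - 1 : ℤ)) : ℚ_[p])‖ < 1 := by rw [← hAint, hA, norm_sub_rev]; exact hAlt
    have hdvd : (p : ℤ) ∣ a ^ (p - 1) - 1 := Padic.norm_intCast_lt_one_iff.mp hlt
    have h := (Padic.norm_int_le_pow_iff_dvd (a ^ (p - 1) - 1) 1).mpr (by simpa using hdvd)
    rw [hAint]; simpa using h
  -- the expansion
  have hlog : padicLog p (a : ℚ_[p]) = ((p : ℚ_[p]) - 1)⁻¹ * padicLogSeries p y := by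
    rw [padicLog_of_ne_zero ha0, hval, neg_zero, zpow_zero, mul_one]
  have hR : ‖padicLogSeries p y + (1 - y)‖ ≤ ‖A‖ ^ 2 := by
    have h := norm_padicLogSeries_add_le (p := p) hAlt
    have h2 : ‖(2 : ℚ_[p])⁻¹‖ = 1 := by
      rw [norm_inv, show (2 : ℚ_[p]) = ((2 : ℕ) : ℚ_[p]) by norm_num, Padic.norm_natCast_eq_one_iff.mpr
        ((Nat.coprime_primes hpP Nat.prime_two).mpr hp2), inv_one]
    rw [h2, mul_one, norm_sub_rev, show ‖y - 1‖ = ‖A‖ from by rw [hA]] at h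
    exact h
  have hc1 : ‖((p : ℚ_[p]) - 1)⁻¹‖ = 1 := by
    rw [norm_inv]
    have : ‖(p : ℚ_[p]) - 1‖ = 1 := by
      rw [show (p : ℚ_[p]) - 1 = ((p - 1 : ℕ) : ℚ_[p]) by rw [Nat.cast_sub hpP.one_le, Nat.cast_one],
        Padic.norm_natCast_eq_one_iff]
      exact (Nat.coprime_self_sub_right hpP.one_le).mpr (Nat.coprime_one_right p)
    rw [this, inv_one]
  have hp0 : (p : ℚ_[p]) - 1 ≠ 0 := natCast_prime_sub_one_ne_zero
  -- `log a + A = (p−1)⁻¹·(L(y) + (1 − y)) + p(p−1)⁻¹·A`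
  have e : padicLog p (a : ℚ_[p]) + A =
      ((p : ℚ_[p]) - 1)⁻¹ * (padicLogSeries p y + (1 - y)) + (p : ℚ_[p]) * ((p : ℚ_[p]) - 1)⁻¹ * A := by
    rw [hlog, hA]; field_simp; ring
  rw [e]
  refine (norm_add_le_max _ _).trans (max_le ?_ ?_)
  · rw [norm_mul, hc1, one_mul]
    refine hR.trans ?_
    rw [pow_two]
    exact mul_le_mul_of_nonneg_right hAle (norm_nonneg _)
  · rw [norm_mul, norm_mul, hc1, mul_one, Padic.norm_p]

/-- **`log_p` of a Tate parameter to its second digit, generic**: `q ≠ 0` with unit part `u`, `u₁` with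
`‖u₁‖ ≤ 1`, `B₁ = u₁^{p−1} − 1 ≠ 0`, `‖u − u₁‖ ≤ p⁻¹‖B₁‖` ⟹ `‖log_p q + B₁‖ ≤ p⁻¹‖B₁‖`. [cite: Iwasawa1972PadicL, §4.4] -/
theorem norm_padicLog_add_unitApprox_le (hp2 : p ≠ 2) {q u₁ : ℚ_[p]} (hq0 : q ≠ 0) (hu₁ : ‖u₁‖ ≤ 1)
    (hB₁ : u₁ ^ (p - 1) - 1 ≠ 0)
    (happ : ‖q * (p : ℚ_[p]) ^ (-q.valuation) - u₁‖ ≤ (p : ℝ)⁻¹ * ‖u₁ ^ (p - 1) - 1‖) :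
    ‖padicLog p q + (u₁ ^ (p - 1) - 1)‖ ≤ (p : ℝ)⁻¹ * ‖u₁ ^ (p - 1) - 1‖ := by
  have hpP : p.Prime := Fact.out
  have hp1 : (1 : ℝ) < p := by exact_mod_cast hpP.one_lt
  have hpinv1 : (p : ℝ)⁻¹ < 1 := inv_lt_one_of_one_lt₀ hp1
  set u : ℚ_[p] := q * (p : ℚ_[p]) ^ (-q.valuation) with hu
  set B₁ : ℚ_[p] := u₁ ^ (p - 1) - 1 with hB₁def
  set B : ℚ_[p] := u ^ (p - 1) - 1 with hBdef
  have hun : ‖u‖ = 1 := norm_mul_zpow_neg_valuation hq0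
  have hB₁pos : 0 < ‖B₁‖ := norm_pos_iff.mpr hB₁
  -- `‖B − B₁‖ ≤ ‖u − u₁‖ ≤ p⁻¹‖B₁‖ < ‖B₁‖`, so `‖B‖ = ‖B₁‖`
  have hpow : ∀ n : ℕ, ‖u ^ n - u₁ ^ n‖ ≤ ‖u - u₁‖ := by
    intro n
    induction n with
    | zero => simp
    | succ n ih =>
      have hid : u ^ (n + 1) - u₁ ^ (n + 1) = u * (u ^ n - u₁ ^ n) + u₁ ^ n * (u - u₁) := by ring
      rw [hid]
      refine (norm_add_le_max _ _).trans (max_le ?_ ?_)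
      · rw [norm_mul]
        calc ‖u‖ * ‖u ^ n - u₁ ^ n‖ ≤ 1 * ‖u - u₁‖ := mul_le_mul hun.le ih (norm_nonneg _) zero_le_one
          _ = ‖u - u₁‖ := one_mul _
      · rw [norm_mul, norm_pow]
        calc ‖u₁‖ ^ n * ‖u - u₁‖ ≤ 1 * ‖u - u₁‖ :=
              mul_le_mul_of_nonneg_right (pow_le_one₀ (norm_nonneg _) hu₁) (norm_nonneg _)
          _ = ‖u - u₁‖ := one_mul _
  have hBB₁ : ‖B - B₁‖ ≤ (p : ℝ)⁻¹ * ‖B₁‖ := by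
    rw [show B - B₁ = u ^ (p - 1) - u₁ ^ (p - 1) by rw [hBdef, hB₁def]; ring]
    exact (hpow _).trans happ
  have hBB₁lt : ‖B - B₁‖ < ‖B₁‖ := hBB₁.trans_lt (by
    calc (p : ℝ)⁻¹ * ‖B₁‖ < 1 * ‖B₁‖ := mul_lt_mul_of_pos_right hpinv1 hB₁pos
      _ = ‖B₁‖ := one_mul _)
  have hBn : ‖B‖ = ‖B₁‖ := by
    have h := norm_add_eq_max_of_norm_ne_norm hBB₁lt.ne'
    rw [add_sub_cancel, max_eq_left hBB₁lt.le] at h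
    exact h
  -- `‖B‖ < 1` and `‖B‖ ≤ p⁻¹` (principal unit)
  have hBlt : ‖1 - u ^ (p - 1)‖ < 1 := by
    rw [norm_sub_rev]; exact norm_pow_sub_one_lt_one_of_norm_eq_one hun
  have hBle : ‖B‖ ≤ (p : ℝ)⁻¹ := by
    have h := (Padic.norm_le_pow_iff_norm_lt_pow_add_one B (-1)).mpr (by
      rw [neg_add_cancel, zpow_zero, hBdef, norm_sub_rev]; exact hBlt)
    rwa [zpow_neg_one] at h
  -- the expansion of `log_p q`
  have hlog : padicLog p q = ((p : ℚ_[p]) - 1)⁻¹ * padicLogSeries p (u ^ (p - 1)) := by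
    rw [padicLog_of_ne_zero hq0]
  have hR : ‖padicLogSeries p (u ^ (p - 1)) + (1 - u ^ (p - 1))‖ ≤ ‖B‖ ^ 2 := by
    have h := norm_padicLogSeries_add_le (p := p) hBlt
    have h2 : ‖(2 : ℚ_[p])⁻¹‖ = 1 := by
      rw [norm_inv, show (2 : ℚ_[p]) = ((2 : ℕ) : ℚ_[p]) by norm_num, Padic.norm_natCast_eq_one_iff.mpr
        ((Nat.coprime_primes hpP Nat.prime_two).mpr hp2), inv_one]
    rw [h2, mul_one, norm_sub_rev, show ‖u ^ (p - 1) - 1‖ = ‖B‖ from by rw [hBdef]] at h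
    exact h
  have hc1 : ‖((p : ℚ_[p]) - 1)⁻¹‖ = 1 := by
    rw [norm_inv]
    have : ‖(p : ℚ_[p]) - 1‖ = 1 := by
      rw [show (p : ℚ_[p]) - 1 = ((p - 1 : ℕ) : ℚ_[p]) by rw [Nat.cast_sub hpP.one_le, Nat.cast_one],
        Padic.norm_natCast_eq_one_iff]
      exact (Nat.coprime_self_sub_right hpP.one_le).mpr (Nat.coprime_one_right p)
    rw [this, inv_one]
  have hp0 : (p : ℚ_[p]) - 1 ≠ 0 := natCast_prime_sub_one_ne_zero
  have e : padicLog p q + B₁ =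
      ((p : ℚ_[p]) - 1)⁻¹ * (padicLogSeries p (u ^ (p - 1)) + (1 - u ^ (p - 1))) +
        (p : ℚ_[p]) * ((p : ℚ_[p]) - 1)⁻¹ * B + (B₁ - B) := by
    rw [hlog, hBdef]; field_simp; ring
  rw [e]
  refine (norm_add_le_max _ _).trans (max_le ((norm_add_le_max _ _).trans (max_le ?_ ?_)) ?_)
  · rw [norm_mul, hc1, one_mul]
    refine hR.trans ?_
    rw [pow_two, hBn]
    exact mul_le_mul_of_nonneg_right (hBn ▸ hBle) (norm_nonneg _)
  · rw [norm_mul, norm_mul, hc1, mul_one, Padic.norm_p, hBn]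
  · rw [norm_sub_rev]; exact hBB₁

end Digits

/-! ### §8 The factors of the 𝓛-term to one more digit -/

section LTerm

variable {W : WeierstrassCurve ℚ}

/-- **`‖log_E(z)² − z²‖ ≤ p⁻¹·‖z‖²`** for `W` globally minimal, `p` odd, `P = (x, y)` rational with `‖x‖_p > 1`,
`z = −x/y`: `‖log_E z − z‖ ≤ 2‖z‖²` (tree, AEC IV.6.4) improves to `≤ ‖z‖²` by discreteness of `‖·‖_p` (`2 < p`), and
`‖z‖² ≤ p⁻¹‖z‖`, `‖log_E z + z‖ = ‖z‖`. [cite: SilvermanAEC2009, IV.6.3(a), IV.6.4, VII.2.2] -/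
theorem norm_padicFormalLog_sq_sub_sq_le (hp2 : p ≠ 2) [W.IsElliptic] [W.IsGloballyMinimal] {x y : ℚ}
    (hxy : W.toAffine.Nonsingular x y) (hx : 1 < ‖(x : ℚ_[p])‖) :
    ‖(W.baseChange ℚ_[p]).padicFormalLog (-(x : ℚ_[p]) / y) ^ 2 - (-(x : ℚ_[p]) / y) ^ 2‖ ≤
      (p : ℝ)⁻¹ * ‖-(x : ℚ_[p]) / y‖ ^ 2 := by
  have hpP : p.Prime := Fact.out
  have hp1 : (1 : ℝ) < p := by exact_mod_cast hpP.one_lt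
  have hp3 : (3 : ℝ) ≤ p := by
    have h2 := hpP.two_le
    exact_mod_cast (show 3 ≤ p by omega)
  obtain ⟨hz, hz2⟩ := norm_neg_div_of_one_lt_norm (p := p) hxy hx
  set z : ℚ_[p] := -(x : ℚ_[p]) / y with hzdef
  set ℓ : ℚ_[p] := (W.baseChange ℚ_[p]).padicFormalLog z with hℓ
  have hzpos : 0 < ‖z‖ := by
    have h : 0 < ‖z‖ ^ 2 := by rw [hz2]; exact inv_pos.mpr (one_pos.trans hx)
    rcases (norm_nonneg z).eq_or_lt with h0 | h0
    · rw [← h0] at h; norm_num at h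
    · exact h0
  have hz0 : z ≠ 0 := norm_pos_iff.mp hzpos
  -- `‖z‖ = p^{−k}` for some integer, and `‖ℓ − z‖ ≤ 2‖z‖² < p·‖z‖²` ⟹ `‖ℓ − z‖ ≤ ‖z‖²`
  have hw := norm_padicFormalLog_sub_self_le_two_mul_sq (W.baseChange ℚ_[p]) hz
  have hdiff : ‖ℓ - z‖ ≤ ‖z‖ ^ 2 := by
    have hzn : ‖z‖ = (p : ℝ) ^ (-z.valuation) := Padic.norm_eq_zpow_neg_valuation hz0
    have hsq : ‖z‖ ^ 2 = (p : ℝ) ^ (2 * (-z.valuation)) := by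
      rw [hzn, ← zpow_natCast, ← zpow_mul, mul_comm]; norm_cast
    rw [hsq, Padic.norm_le_pow_iff_norm_lt_pow_add_one]
    refine hw.trans_lt ?_
    rw [hsq, zpow_add_one₀ (by positivity : (p : ℝ) ≠ 0), mul_comm]
    exact mul_lt_mul_of_pos_left (by linarith) (zpow_pos (by positivity) _)
  have hdiff' : ‖ℓ - z‖ ≤ (p : ℝ)⁻¹ * ‖z‖ := by
    refine hdiff.trans ?_
    rw [pow_two]
    exact mul_le_mul_of_nonneg_right hz (norm_nonneg _)
  have hsum : ‖ℓ + z‖ ≤ ‖z‖ := by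
    have e : ℓ + z = (ℓ - z) + 2 * z := by ring
    rw [e]
    refine (norm_add_le_max _ _).trans (max_le (hdiff'.trans ?_) ?_)
    · calc (p : ℝ)⁻¹ * ‖z‖ ≤ 1 * ‖z‖ :=
            mul_le_mul_of_nonneg_right (inv_le_one_of_one_le₀ hp1.le) (norm_nonneg _)
        _ = ‖z‖ := one_mul _
    · rw [norm_mul]
      calc ‖(2 : ℚ_[p])‖ * ‖z‖ ≤ 1 * ‖z‖ := by
            refine mul_le_mul_of_nonneg_right ?_ (norm_nonneg _)
            simpa using Padic.norm_int_le_one (p := p) 2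
        _ = ‖z‖ := one_mul _
  have e : ℓ ^ 2 - z ^ 2 = (ℓ - z) * (ℓ + z) := by ring
  rw [e, norm_mul]
  calc ‖ℓ - z‖ * ‖ℓ + z‖ ≤ ((p : ℝ)⁻¹ * ‖z‖) * ‖z‖ := mul_le_mul hdiff' hsum (norm_nonneg _) (by positivity)
    _ = (p : ℝ)⁻¹ * ‖z‖ ^ 2 := by ring

/-- **`‖C⁻² + c₆/c₄‖ ≤ ‖q‖`**: the inverse squared uniformisation scale is `−(c₆/c₄)(W)·E₄(q)/E₆(q)` with
`‖E₄(q) − 1‖, ‖E₆(q) − 1‖ ≤ ‖q‖` (`E₄ = 1 + 240s₃`, `E₆ = 1 − 504s₅`, `‖s_k(q)‖ ≤ ‖q‖`), at a multiplicative prime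
(`‖c₄‖ = ‖c₆‖ = 1`). [cite: SilvermanATAEC1994, Ch. V §1 (1.1), Thm. V.3.1] [cite: SteinWuthrich2013, §4.2] -/
theorem norm_inv_uniformisationScaleSq_add_le [W.IsElliptic] [W.IsGloballyMinimal] (hW : Mult W p)
    {q : ℚ_[p]} (hq : ‖q‖ < 1) :
    ‖(uniformisationScaleSq W p q)⁻¹ + (W.c₆ : ℚ_[p]) / (W.c₄ : ℚ_[p])‖ ≤ ‖q‖ := by
  have h4 : ‖(W.c₄ : ℚ_[p])‖ = 1 := norm_c₄_eq_one_of_hasMultiplicativeReductionAtPrime hW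
  have h6 : ‖(W.c₆ : ℚ_[p])‖ = 1 := norm_c₆_eq_one_of_mult hW
  have hc₄ : (W.baseChange ℚ_[p]).c₄ = (W.c₄ : ℚ_[p]) := (map_c₄ W (algebraMap ℚ ℚ_[p])).trans (eq_ratCast _ _)
  have hc₆ : (W.baseChange ℚ_[p]).c₆ = (W.c₆ : ℚ_[p]) := (map_c₆ W (algebraMap ℚ ℚ_[p])).trans (eq_ratCast _ _)
  have h12 : (12 : ℚ_[p]) ≠ 0 := by norm_num
  have hE4 : ‖tateE4 q - 1‖ ≤ ‖q‖ := by
    rw [tateE4_eq, add_sub_cancel_left, norm_mul]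
    calc ‖(240 : ℚ_[p])‖ * ‖tateS 3 q‖ ≤ 1 * ‖q‖ := by
          refine mul_le_mul ?_ (norm_tateS_le hq.le) (norm_nonneg _) zero_le_one
          simpa using Padic.norm_int_le_one (p := p) 240
      _ = ‖q‖ := one_mul _
  have hE6 : ‖tateE6 q - 1‖ ≤ ‖q‖ := by
    rw [tateE6, sub_sub_cancel_left, norm_neg, norm_mul]
    calc ‖(504 : ℚ_[p])‖ * ‖tateS 5 q‖ ≤ 1 * ‖q‖ := by
          refine mul_le_mul ?_ (norm_tateS_le hq.le) (norm_nonneg _) zero_le_one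
          simpa using Padic.norm_int_le_one (p := p) 504
      _ = ‖q‖ := one_mul _
  have hE4n : ‖tateE4 q‖ = 1 := norm_tateE4_eq_one hq
  have hE6n : ‖tateE6 q‖ = 1 := norm_tateE6_eq_one hq
  have hE60 : tateE6 q ≠ 0 := norm_pos_iff.mp (by rw [hE6n]; exact one_pos)
  have hc40 : (W.c₄ : ℚ_[p]) ≠ 0 := norm_pos_iff.mp (by rw [h4]; exact one_pos)
  have hc60 : (W.c₆ : ℚ_[p]) ≠ 0 := norm_pos_iff.mp (by rw [h6]; exact one_pos)
  unfold uniformisationScaleSq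
  rw [tateCurve_c₄, tateCurve_c₆ h12, hc₄, hc₆]
  have e : (-tateE6 q * (W.c₄ : ℚ_[p]) / (tateE4 q * (W.c₆ : ℚ_[p])))⁻¹ + (W.c₆ : ℚ_[p]) / (W.c₄ : ℚ_[p]) =
      ((W.c₆ : ℚ_[p]) / (W.c₄ : ℚ_[p])) * ((tateE6 q - 1) - (tateE4 q - 1)) / tateE6 q := by
    field_simp
    ring
  rw [e, norm_div, norm_mul, norm_div, h6, h4, hE6n]
  simp only [div_one, one_mul]
  rw [sub_eq_add_neg]
  refine (IsUltrametricDist.norm_add_le_max _ _).trans ?_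
  rw [norm_neg]
  exact max_le hE6 hE4

end LTerm

end Summit.BirchSwinnertonDyer.Rank1Residual.X11b.RegMult.HeightLogNumerator

end
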